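import Literature.InformationTheory.QuantumCodes.QuantumExpanderSmallSetFlipMinMax
import HarnessLib

/-!
# FGL18 Theorem 1 WITHOUT the convention `Δ_A ≤ Δ_B`: the named fact `FGL18_theorem1` DISCHARGED, and the
# `Z`-sector of every quantum expander code

Index of sources: `[cite: FawziGrospellierLeverrier2018]` = Fawzi–Grospellier–Leverrier, "Efficient decoding of
random errors for quantum expander codes", STOC 2018 / arXiv:1711.08351v2 (Thm 1 §1; §3.2 Remark 9, Def 10, Prop 11;
§3.3; §4); `[cite: LeverrierTillichZemor2015]` = Leverrier–Tillich–Zémor, FOCS 2015 / arXiv:1504.00822.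

qec PARTITION v2 row 04 (`prover-qec-type-04`, gen 4), item 04.FGL1x, second file. The tree's threshold theorem
`QuantumExpander.fgl18_theorem1_beta` / `fgl18_theorem1_of_le` / `FGL18_theorem1_le_holds` carries the source's
standing convention `Δ_A ≤ Δ_B`. Here the same assembly is run with the convention-free Proposition 11
(`fgl18_proposition11_minmax`: parameter `κ̃ = β̃·max(Δ_A,Δ_B)`, `β̃ = betaZero (min Δ_A Δ_B) (max Δ_A Δ_B) δ_A δ_B`,
radius `(r̃β̃/(1+β̃))·min(γ_A n_A, γ_B n_B)`), the convention-free column weights (every qubit lies in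
`≤ max(Δ_A,Δ_B)` checks and `≤ max(Δ_A,Δ_B)` generators, so `𝒢` has degree `≤ 2max(Δ_A,Δ_B)(Δ_A+Δ_B−1)`), and the
size relations written with `max(n_A, n_B)`:

* `fgl18_theorem1_minmax` — **Theorem 1 for every biregular quantum expander code** (`1 ≤ Δ_A, Δ_B`, `β₀ > 0`, no
  order between the degrees) and every parameter `κ ≤ κ̃` (Algorithm 1 included, via Remark 9 =
  `SmallSetFlip.exists_dominating_sum_le`), constants `p₀ = (4Δ²)^{-1/α}`, `C = 2`, `C' = α c₀ m/2` with
  `Δ = 2max(Δ_A,Δ_B)(Δ_A+Δ_B)`, `α = β̃/(1+β̃)`, `c₀ = r̃β̃/(1+β̃)`, `m = min(γ_A,γ_B)·r̃`;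
* `FGL18_theorem1_holds : FGL18_theorem1` — the named fact AS FIRST TYPED (Algorithm 1, NO convention; recorded so
  far as "stronger than printed for `Δ_A > Δ_B`, no witness known") is TRUE and DISCHARGED;
* `fgl18_proposition11_transpose`, `fgl18_theorem1_transpose` — the **`Z`-sector**: the adversarial radius and the
  same threshold bound for the decoders of the reversed graph `Hᵀ` (degrees `(Δ_B, Δ_A)`), for EVERY biregular
  expander — the case the convention could not reach when `Δ_A < Δ_B`.

All statements PROVED (kernel axioms); no definitions, no named facts; no running-time claims.
-/

namespace Literature.InformationTheory.QuantumCodes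

namespace QuantumExpander

open Finset Matrix Literature.Probability.LatticeModels

/-! ### Convention-free column weights and the degree of `𝒢` -/

section Degrees

variable {A B : Type*} [Fintype A] [Fintype B] [DecidableEq A] [DecidableEq B]

/-- **Column weights of `H_X`, convention-free**: every qubit lies in at most `max(Δ_A, Δ_B)` `X`-checks (an
`A²`-qubit `αa'` in the `Δ_A` checks `αβ`, `β ∼ a'`; a `B²`-qubit `b'β'` in the `Δ_B` checks `αβ'`, `α ∼ b'`).
[cite: LeverrierTillichZemor2015, §2 (𝒢_X: "Γ(αa) = {αβ : a ∼ β}", "Γ(bβ) = {αβ : α ∼ b}"; arXiv v1 p0005)] -/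
theorem card_col_expanderHX_le_max (H : Matrix B A (ZMod 2)) {dA dB : ℕ} (hreg : IsBiregular H dA dB)
    (q : (A × A) ⊕ (B × B)) :
    (univ.filter fun c : A × B => expanderHX H c q ≠ 0).card ≤ max dA dB := by
  classical
  rcases q with ⟨α, a'⟩ | ⟨b', β'⟩
  · have hsub : (univ.filter fun c : A × B => expanderHX H c (Sum.inl (α, a')) ≠ 0)
        ⊆ (nbrs H a').image fun β => (α, β) := by
      rintro ⟨α'', β⟩ hc
      rw [Finset.mem_filter] at hc
      have h := hc.2
      simp only [expanderHX, HypergraphProduct.zMatrix_apply_inl, Matrix.transpose_apply] at h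
      have hαα : α'' = α := by
        by_contra hne; exact h (by simp [hne])
      subst hαα
      have hβ : H β a' ≠ 0 := by
        intro h0; exact h (by simp [h0])
      exact Finset.mem_image.2 ⟨β, mem_nbrs.2 hβ, rfl⟩
    calc _ ≤ ((nbrs H a').image fun β => (α, β)).card := Finset.card_le_card hsub
      _ ≤ (nbrs H a').card := Finset.card_image_le
      _ = dA := card_nbrs_eq H hreg a'
      _ ≤ max dA dB := le_max_left _ _
  · have hsub : (univ.filter fun c : A × B => expanderHX H c (Sum.inr (b', β')) ≠ 0)
        ⊆ (nbrs Hᵀ b').image fun α => (α, β') := by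
      rintro ⟨α, β''⟩ hc
      rw [Finset.mem_filter] at hc
      have h := hc.2
      simp only [expanderHX, HypergraphProduct.zMatrix_apply_inr] at h
      have hββ : β'' = β' := by
        by_contra hne; exact h (by simp [hne])
      subst hββ
      have hα : H b' α ≠ 0 := by
        intro h0; exact h (by simp [h0])
      exact Finset.mem_image.2 ⟨α, by rw [mem_nbrs, Matrix.transpose_apply]; exact hα, rfl⟩
    calc _ ≤ ((nbrs Hᵀ b').image fun α => (α, β')).card := Finset.card_le_card hsub
      _ ≤ (nbrs Hᵀ b').card := Finset.card_image_le
      _ = dB := card_nbrs_transpose_eq H hreg b'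
      _ ≤ max dA dB := le_max_right _ _

/-- **Column weights of `H_Z`, convention-free**: every qubit lies in at most `max(Δ_A, Δ_B)` `Z`-generators.
[cite: LeverrierTillichZemor2015, §3 eq. (g_ba) (the generators g_{ba}; arXiv v1 p0007)] -/
theorem card_col_expanderHZ_le_max (H : Matrix B A (ZMod 2)) {dA dB : ℕ} (hreg : IsBiregular H dA dB)
    (q : (A × A) ⊕ (B × B)) :
    (univ.filter fun g : B × A => expanderHZ H g q ≠ 0).card ≤ max dA dB := by
  classical
  rcases q with ⟨α, a'⟩ | ⟨b', β'⟩
  · have hsub : (univ.filter fun g : B × A => expanderHZ H g (Sum.inl (α, a')) ≠ 0)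
        ⊆ (nbrs H α).image fun b => (b, a') := by
      rintro ⟨b, a⟩ hg
      rw [Finset.mem_filter] at hg
      have h := hg.2
      rw [expanderHZ_row_apply_inl] at h
      have haa : a = a' := by
        by_contra hne; exact h (by simp [hne])
      have hb : H b α ≠ 0 := by
        intro h0; exact h (by simp [h0])
      rw [haa]
      exact Finset.mem_image.2 ⟨b, mem_nbrs.2 hb, rfl⟩
    calc _ ≤ ((nbrs H α).image fun b => (b, a')).card := Finset.card_le_card hsub
      _ ≤ (nbrs H α).card := Finset.card_image_le
      _ = dA := card_nbrs_eq H hreg α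
      _ ≤ max dA dB := le_max_left _ _
  · have hsub : (univ.filter fun g : B × A => expanderHZ H g (Sum.inr (b', β')) ≠ 0)
        ⊆ (nbrs Hᵀ β').image fun a => (b', a) := by
      rintro ⟨b, a⟩ hg
      rw [Finset.mem_filter] at hg
      have h := hg.2
      rw [expanderHZ_row_apply_inr] at h
      have hbb : b = b' := by
        by_contra hne; exact h (by simp [hne])
      have ha : H β' a ≠ 0 := by
        intro h0; exact h (by simp [h0])
      rw [hbb]
      exact Finset.mem_image.2 ⟨a, by rw [mem_nbrs, Matrix.transpose_apply]; exact ha, rfl⟩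
    calc _ ≤ ((nbrs Hᵀ β').image fun a => (b', a)).card := Finset.card_le_card hsub
      _ ≤ (nbrs Hᵀ β').card := Finset.card_image_le
      _ = dB := card_nbrs_transpose_eq H hreg β'
      _ ≤ max dA dB := le_max_right _ _

/-- **Column weights of the stacked matrix `(H_X; H_Z)`, convention-free**: every qubit lies in at most
`2max(Δ_A, Δ_B)` checks + generators. [cite: LeverrierTillichZemor2015, §3 (qubit degrees of the quantum expander code; arXiv v1 p0006)] -/
theorem card_col_fromRows_le_max (H : Matrix B A (ZMod 2)) {dA dB : ℕ} (hreg : IsBiregular H dA dB)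
    (q : (A × A) ⊕ (B × B)) :
    (univ.filter fun i : (A × B) ⊕ (B × A) => Matrix.fromRows (expanderHX H) (expanderHZ H) i q ≠ 0).card
      ≤ 2 * max dA dB := by
  classical
  have hsub : (univ.filter fun i : (A × B) ⊕ (B × A) => Matrix.fromRows (expanderHX H) (expanderHZ H) i q ≠ 0)
      ⊆ (univ.filter fun c : A × B => expanderHX H c q ≠ 0).map Function.Embedding.inl
        ∪ (univ.filter fun g : B × A => expanderHZ H g q ≠ 0).map Function.Embedding.inr := by
    intro i hi
    rw [Finset.mem_filter] at hi
    rcases i with c | g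
    · rw [Matrix.fromRows_apply_inl] at hi
      exact Finset.mem_union_left _
        (Finset.mem_map_of_mem _ (Finset.mem_filter.2 ⟨Finset.mem_univ _, hi.2⟩))
    · rw [Matrix.fromRows_apply_inr] at hi
      exact Finset.mem_union_right _
        (Finset.mem_map_of_mem _ (Finset.mem_filter.2 ⟨Finset.mem_univ _, hi.2⟩))
  calc _ ≤ _ := Finset.card_le_card hsub
    _ ≤ ((univ.filter fun c : A × B => expanderHX H c q ≠ 0).map Function.Embedding.inl).card
          + ((univ.filter fun g : B × A => expanderHZ H g q ≠ 0).map Function.Embedding.inr).card :=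
        Finset.card_union_le _ _
    _ ≤ max dA dB + max dA dB := by
        rw [Finset.card_map, Finset.card_map]
        exact Nat.add_le_add (card_col_expanderHX_le_max H hreg q) (card_col_expanderHZ_le_max H hreg q)
    _ = 2 * max dA dB := (two_mul _).symm

/-- **Degree of the adjacency graph `𝒢`, convention-free**: `deg ≤ 2max(Δ_A,Δ_B)(Δ_A + Δ_B − 1)` (row weights
`Δ_A + Δ_B`, qubit degrees `≤ 2max(Δ_A,Δ_B)`).
[cite: FawziGrospellierLeverrier2018, §2.4 ("𝒢 has degree upper bounded by some constant d which depends on the weights of the generators and the qubit degrees"; arXiv v2 p0008)] -/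
theorem degree_checkGraph_fromRows_le_max (H : Matrix B A (ZMod 2)) {dA dB : ℕ} (hreg : IsBiregular H dA dB)
    [DecidableRel (checkGraph (Matrix.fromRows (expanderHX H) (expanderHZ H))).Adj]
    (q : (A × A) ⊕ (B × B)) :
    (checkGraph (Matrix.fromRows (expanderHX H) (expanderHZ H))).degree q
      ≤ 2 * max dA dB * (dA + dB - 1) :=
  degree_checkGraph_le _ (card_row_fromRows_le H hreg) (card_col_fromRows_le_max H hreg) q

end Degrees

/-! ### Proposition 11 (convention-free) for single runs -/

section Runs

variable {A B : Type*} [Fintype A] [Fintype B] [DecidableEq A] [DecidableEq B]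

/-- **Prop 11 without the convention, run form**: EVERY complete valid run of parameter `κ̃ = β̃·max(Δ_A,Δ_B)` from
`σ_X(e)` with `|e| ≤ (r̃β̃/(1+β̃))·min(γ_A n_A, γ_B n_B)` ends with `e ⊕ Ê ∈ C_Z^⊥` (freeze a decoder to this run on
the syndrome `σ_X(e)`). [cite: FawziGrospellierLeverrier2018, Prop 11 (§3.2, arXiv v2 p0011; "any non-deterministic choice of the Fᵢ")] -/
theorem add_runOutput_mem_rowSpace_minmax (H : Matrix B A (ZMod 2)) {dA dB : ℕ} {γA δA γB δB : ℝ}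
    (hreg : IsBiregular H dA dB) (hexp : IsLeftRightExpanding H dA dB γA δA γB δB)
    (hdA : 0 < dA) (hdB : 0 < dB) (hδA : 0 < δA) (hδB : 0 < δB)
    (hβ : 0 < betaZero (min dA dB) (max dA dB) δA δB)
    {e : (A × A) ⊕ (B × B) → ZMod 2} {l : List (Finset ((A × A) ⊕ (B × B)))}
    (hrun : IsSSFRun (betaZero (min dA dB) (max dA dB) δA δB * ((max dA dB : ℕ) : ℝ))
      (expanderHX H) (expanderHZ H) (expanderHX H *ᵥ e) l)
    (he : (hammingNorm e : ℝ) ≤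
      ((min dA dB : ℕ) : ℝ) / ((max dA dB : ℕ) : ℝ) * betaZero (min dA dB) (max dA dB) δA δB
        / (1 + betaZero (min dA dB) (max dA dB) δA δB) * min (γA * Fintype.card A) (γB * Fintype.card B)) :
    e + runOutput l ∈ rowSpace (expanderHZ H) := by
  classical
  set κ : ℝ := betaZero (min dA dB) (max dA dB) δA δB * ((max dA dB : ℕ) : ℝ) with hκdef
  obtain ⟨D₀, hD₀⟩ := exists_isSSFDecoder κ (expanderHX H) (expanderHZ H)
  set D : Decoder (A × B → ZMod 2) ((A × A) ⊕ (B × B) → ZMod 2) :=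
    fun σ => if σ = expanderHX H *ᵥ e then runOutput l else D₀ σ with hDdef
  have hD : IsSSFDecoder κ (expanderHX H) (expanderHZ H) D := by
    intro σ
    by_cases hσ : σ = expanderHX H *ᵥ e
    · refine ⟨l, hσ ▸ hrun, ?_⟩
      simp [hDdef, hσ]
    · obtain ⟨l', h1, h2⟩ := hD₀ σ
      exact ⟨l', h1, by simp [hDdef, hσ, h2]⟩
  have hc := fgl18_proposition11_minmax H hreg hexp hdA hdB hδA hδB hβ D hD e he
  have hDe : D (expanderHX H *ᵥ e) = runOutput l := by simp [hDdef]
  change D (expanderHX H *ᵥ e) + e ∈ (rowSpace (expanderHZ H) : Set _) at hc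
  rw [hDe, add_comm] at hc
  exact hc

end Runs

/-! ### Size relations without `n_B ≤ n_A` -/

section Sizes

/-- `√(n_A² + n_B²) ≤ 2 max(n_A, n_B)`. [folklore] -/
private theorem sqrt_sq_add_sq_le_two_max {x y : ℝ} (hx : 0 ≤ x) (hy : 0 ≤ y) :
    Real.sqrt (x ^ 2 + y ^ 2) ≤ 2 * max x y := by
  have hM : 0 ≤ max x y := hx.trans (le_max_left x y)
  rw [show (2 : ℝ) * max x y = Real.sqrt ((2 * max x y) ^ 2) by rw [Real.sqrt_sq (by linarith)]]
  refine Real.sqrt_le_sqrt ?_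
  have h1 : x ≤ max x y := le_max_left x y
  have h2 : y ≤ max x y := le_max_right x y
  nlinarith

/-- For a biregular graph (`n_AΔ_A = n_BΔ_B`) and nonnegative `γ`'s,
`min(γ_A, γ_B)·(min(Δ_A,Δ_B)/max(Δ_A,Δ_B))·max(n_A, n_B) ≤ min(γ_A n_A, γ_B n_B)`. [folklore] -/
private theorem min_mul_max_le_min {nA nB dA dB γA γB : ℝ} (hnA : 0 ≤ nA) (hnB : 0 ≤ nB)
    (hdA : 0 < dA) (hdB : 0 < dB) (hγA : 0 ≤ γA) (hγB : 0 ≤ γB) (hAB : nA * dA = nB * dB) :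
    min γA γB * (min dA dB / max dA dB) * max nA nB ≤ min (γA * nA) (γB * nB) := by
  set r : ℝ := min dA dB / max dA dB with hr
  have hM : 0 < max dA dB := lt_max_of_lt_left hdA
  have hr0 : 0 ≤ r := by rw [hr]; exact div_nonneg (le_min hdA.le hdB.le) hM.le
  have hr1 : r ≤ 1 := by
    rw [hr, div_le_one hM]; exact min_le_of_left_le (le_max_left _ _)
  have hrAB : r ≤ dA / dB := by
    rw [hr, div_le_div_iff₀ hM hdB]
    exact mul_le_mul (min_le_left _ _) (le_max_right _ _) hdB.le hdA.le
  have hrBA : r ≤ dB / dA := by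
    rw [hr, div_le_div_iff₀ hM hdA]
    exact mul_le_mul (min_le_right _ _) (le_max_left _ _) hdA.le hdB.le
  have hγ0 : 0 ≤ min γA γB := le_min hγA hγB
  rcases le_total nB nA with h | h
  · rw [max_eq_left h]
    refine le_min ?_ ?_
    · have h1 : min γA γB * r ≤ γA * 1 := mul_le_mul (min_le_left _ _) hr1 hr0 hγA
      calc min γA γB * r * nA ≤ γA * 1 * nA := mul_le_mul_of_nonneg_right h1 hnA
        _ = γA * nA := by ring
    · have h1 : min γA γB * r ≤ γB * (dA / dB) := mul_le_mul (min_le_right _ _) hrAB hr0 hγB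
      have hnB' : γB * (dA / dB) * nA = γB * nB := by
        rw [show γB * (dA / dB) * nA = γB * (nA * dA) / dB by ring, hAB]
        field_simp
      calc min γA γB * r * nA ≤ γB * (dA / dB) * nA := mul_le_mul_of_nonneg_right h1 hnA
        _ = γB * nB := hnB'
  · rw [max_eq_right h]
    refine le_min ?_ ?_
    · have h1 : min γA γB * r ≤ γA * (dB / dA) := mul_le_mul (min_le_left _ _) hrBA hr0 hγA
      have hnA' : γA * (dB / dA) * nB = γA * nA := by
        rw [show γA * (dB / dA) * nB = γA * (nB * dB) / dA by ring, ← hAB]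
        field_simp
      calc min γA γB * r * nB ≤ γA * (dB / dA) * nB := mul_le_mul_of_nonneg_right h1 hnB
        _ = γA * nA := hnA'
    · have h1 : min γA γB * r ≤ γB * 1 := mul_le_mul (min_le_right _ _) hr1 hr0 hγB
      calc min γA γB * r * nB ≤ γB * 1 * nB := mul_le_mul_of_nonneg_right h1 hnB
        _ = γB * nB := by ring

end Sizes

/-! ### The threshold theorem for every biregular quantum expander code -/

section Threshold

open Classical in
/-- **FGL18 Theorem 1 WITHOUT the convention `Δ_A ≤ Δ_B`, for every parameter `κ ≤ β̃·max(Δ_A,Δ_B)`** (PROVED):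
for fixed degrees `Δ_A, Δ_B ≥ 1` (in any order) and expansion parameters with `β₀ > 0` there are `p₀ > 0`, `C`,
`C' > 0` such that for EVERY `(Δ_A, Δ_B)`-biregular `(γ_A, δ_A, γ_B, δ_B)`-expanding `G`, every small-set-flip
decoder of any parameter `κ ≤ β̃·max(Δ_A,Δ_B)` (`β̃ = betaZero (min Δ_A Δ_B) (max Δ_A Δ_B) δ_A δ_B`; Algorithm 1 is
`κ = 0`) and every locally stochastic `X`-error weight of parameter `0 ≤ p < p₀`, the total weight of the
uncorrected error patterns is `≤ C (n_A² + n_B²) (p/p₀)^{C'√(n_A² + n_B²)}`. Proof: for the top parameter `κ̃`, the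
generic reduction `SmallSetFlip.sum_not_corrects_le_geometric` on `𝒢 = checkGraph (H_X; H_Z)` (degree
`≤ Δ = 2max(Δ_A,Δ_B)(Δ_A+Δ_B)`) with the radius of `fgl18_proposition11_minmax` and column bound `max(Δ_A,Δ_B)`; smaller
parameters by domination (Remark 9). Constants: `p₀ = (4Δ²)^{-1/α}`, `C = 2`, `C' = α c₀ m/2`, `α = β̃/(1+β̃)`,
`c₀ = r̃β̃/(1+β̃)`, `m = min(γ_A,γ_B)·r̃`, `r̃ = min/max`.
[cite: FawziGrospellierLeverrier2018, Thm 1 (§1, arXiv v2 p0004) with Remark 9 (p0011) and its proof (§3.3 p0012, §4 p0014)] -/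
theorem fgl18_theorem1_minmax :
    ∀ (dA dB : ℕ) (γA δA γB δB : ℝ), 0 < dA → 0 < dB → 0 < γA → 0 < δA → 0 < γB → 0 < δB →
      0 < betaZero dA dB δA δB →
      ∃ (p₀ C C' : ℝ), 0 < p₀ ∧ 0 < C' ∧
        ∀ (A B : Type) [Fintype A] [Fintype B] [DecidableEq A] [DecidableEq B]
          (H : Matrix B A (ZMod 2)),
          IsBiregular H dA dB → IsLeftRightExpanding H dA dB γA δA γB δB →
          ∀ κ : ℝ, κ ≤ betaZero (min dA dB) (max dA dB) δA δB * ((max dA dB : ℕ) : ℝ) →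
          ∀ D : Decoder (A × B → ZMod 2) ((A × A) ⊕ (B × B) → ZMod 2),
            IsSSFDecoder κ (expanderHX H) (expanderHZ H) D →
            ∀ (p : ℝ) (μ : Finset ((A × A) ⊕ (B × B)) → ℝ), 0 ≤ p → p < p₀ →
              IsLocallyStochastic μ p →
              (∑ E ∈ univ.filter (fun E : Finset ((A × A) ⊕ (B × B)) =>
                  ¬ D.Corrects (fun x => expanderHX H *ᵥ x) (rowSpace (expanderHZ H) : Set _)
                    (flipVec E)), μ E) ≤
                C * ((Fintype.card A : ℝ) ^ 2 + (Fintype.card B : ℝ) ^ 2) *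
                  (p / p₀) ^ (C' * Real.sqrt ((Fintype.card A : ℝ) ^ 2 + (Fintype.card B : ℝ) ^ 2)) := by
  intro dA dB γA δA γB δB hdA hdB hγA hδA hγB hδB hβ0
  -- the constants
  set dm : ℕ := min dA dB with hdmdef
  set dM : ℕ := max dA dB with hdMdef
  set β : ℝ := betaZero dm dM δA δB with hβdef
  have hβ : 0 < β := by rw [hβdef, hdmdef, hdMdef]; exact (betaZero_minmax_pos_iff hdA hdB δA δB).2 hβ0
  set κ : ℝ := β * dM with hκdef
  set α : ℝ := κ / (κ + dM) with hαdef
  set Δ : ℕ := 2 * dM * (dA + dB) with hΔdef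
  set c₀ : ℝ := (dm : ℝ) / dM * β / (1 + β) with hc₀def
  set m : ℝ := min γA γB * ((dm : ℝ) / dM) with hmdef
  set p₀ : ℝ := (4 * (Δ : ℝ) ^ 2) ^ (-(1 / α)) with hp₀def
  set C' : ℝ := α * c₀ * m / 2 with hC'def
  have hdA' : (0 : ℝ) < dA := by exact_mod_cast hdA
  have hdB' : (0 : ℝ) < dB := by exact_mod_cast hdB
  have hdm0 : 0 < dm := lt_min hdA hdB
  have hdM0 : 0 < dM := lt_max_of_lt_left hdA
  have hdm' : (0 : ℝ) < dm := by exact_mod_cast hdm0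
  have hdM' : (0 : ℝ) < dM := by exact_mod_cast hdM0
  have hκ : 0 < κ := mul_pos hβ hdM'
  have hα : 0 < α := div_pos hκ (by linarith)
  have hΔ1 : 1 ≤ Δ := Nat.mul_pos (Nat.mul_pos two_pos hdM0) (Nat.add_pos_left hdA dB)
  have hΔ1' : (1 : ℝ) ≤ Δ := by exact_mod_cast hΔ1
  have hΔsq : (1 : ℝ) ≤ (Δ : ℝ) ^ 2 := one_le_pow₀ hΔ1'
  have h4Δ : (1 : ℝ) ≤ 4 * (Δ : ℝ) ^ 2 := by linarith
  have h4Δpos : (0 : ℝ) < 4 * (Δ : ℝ) ^ 2 := by linarith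
  have hp₀pos : 0 < p₀ := Real.rpow_pos_of_pos h4Δpos _
  have hp₀le : p₀ ≤ 1 :=
    Real.rpow_le_one_of_one_le_of_nonpos h4Δ (neg_nonpos.2 (le_of_lt (div_pos one_pos hα)))
  -- `p₀^α = 1/(4Δ²)`
  have hαne : α ≠ 0 := hα.ne'
  have hp₀α : p₀ ^ α = (4 * (Δ : ℝ) ^ 2)⁻¹ := by
    rw [hp₀def, ← Real.rpow_mul h4Δpos.le, show -(1 / α) * α = -1 by field_simp, Real.rpow_neg_one]
  have hr0 : 0 < (dm : ℝ) / dM := div_pos hdm' hdM'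
  have hc₀ : 0 < c₀ := by
    rw [hc₀def]; exact div_pos (mul_pos hr0 hβ) (by linarith)
  have hm : 0 < m := by rw [hmdef]; exact mul_pos (lt_min hγA hγB) hr0
  have hC' : 0 < C' := by
    rw [hC'def]; exact div_pos (mul_pos (mul_pos hα hc₀) hm) two_pos
  refine ⟨p₀, 2, C', hp₀pos, hC', ?_⟩
  intro A B _ _ _ _ H hreg hexp κ' hκ' D' hD' p μ hp0 hpp₀ hμ
  classical
  -- Remark 9: dominate the `κ'`-decoder by a `κ`-decoder
  obtain ⟨D, hD, hdom⟩ := SmallSetFlip.exists_dominating_sum_le hκ'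
    (fun _ hv => expanderHX_mulVec_eq_zero_of_mem_rowSpace H hv) hD' (fun E => hμ.nonneg E)
  refine hdom.trans ?_
  -- sizes
  set nA : ℝ := (Fintype.card A : ℝ) with hnAdef
  set nB : ℝ := (Fintype.card B : ℝ) with hnBdef
  have hnA : 0 ≤ nA := Nat.cast_nonneg _
  have hnB : 0 ≤ nB := Nat.cast_nonneg _
  have hAB : nA * dA = nB * dB := by
    rw [hnAdef, hnBdef]; exact_mod_cast card_mul_eq_card_mul_of_isBiregular H hreg
  have hV : (Fintype.card ((A × A) ⊕ (B × B)) : ℝ) = nA ^ 2 + nB ^ 2 := by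
    rw [card_qubits]; push_cast; rw [hnAdef, hnBdef]
  -- the radius of Prop 11 and the resulting cluster size
  set t₀ : ℝ := c₀ * min (γA * nA) (γB * nB) with ht₀def
  have ht₀ : 0 ≤ t₀ := mul_nonneg hc₀.le (le_min (mul_nonneg hγA.le hnA) (mul_nonneg hγB.le hnB))
  -- the graph `𝒢` and the hypotheses of the generic reduction
  set G := checkGraph (Matrix.fromRows (expanderHX H) (expanderHZ H)) with hGdef
  have hGX : ∀ c q q', q ≠ q' → expanderHX H c q ≠ 0 → expanderHX H c q' ≠ 0 → G.Adj q q' :=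
    fun c q q' hne h1 h2 => checkGraph_fromRows_adj_of_X H c q q' hne h1 h2
  have hGZ : ∀ g q q', q ≠ q' → expanderHZ H g q ≠ 0 → expanderHZ H g q' ≠ 0 → G.Adj q q' :=
    fun g q q' hne h1 h2 => checkGraph_fromRows_adj_of_Z H g q q' hne h1 h2
  have hw : ∀ v : (A × A) ⊕ (B × B) → ZMod 2,
      (hammingNorm (expanderHX H *ᵥ v) : ℝ) ≤ (dM : ℝ) * hammingNorm v := fun v => by
    rw [hdMdef]; exact_mod_cast hammingNorm_expanderHX_mulVec_le_max H hreg v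
  have hcorr : ∀ (E' : Finset ((A × A) ⊕ (B × B))) (l' : List (Finset ((A × A) ⊕ (B × B)))),
      IsSSFRun κ (expanderHX H) (expanderHZ H) (expanderHX H *ᵥ flipVec E') l' →
      ((E'.card : ℝ) ≤ t₀) → flipVec E' + runOutput l' ∈ rowSpace (expanderHZ H) := by
    intro E' l' hrun hE'
    have hrun' : IsSSFRun (betaZero (min dA dB) (max dA dB) δA δB * ((max dA dB : ℕ) : ℝ))
        (expanderHX H) (expanderHZ H) (expanderHX H *ᵥ flipVec E') l' := by
      rw [← hdmdef, ← hdMdef, ← hβdef, ← hκdef]; exact hrun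
    refine add_runOutput_mem_rowSpace_minmax H hreg hexp hdA hdB hδA hδB
      (by rw [← hdmdef, ← hdMdef, ← hβdef]; exact hβ) hrun' ?_
    rw [hammingNorm_flipVec, ← hdmdef, ← hdMdef, ← hβdef]
    exact hE'.trans_eq (by rw [ht₀def, hc₀def])
  have hdeg : ∀ x, G.degree x ≤ Δ := by
    intro x
    refine (degree_checkGraph_fromRows_le_max H hreg x).trans ?_
    rw [hΔdef, hdMdef]
    exact Nat.mul_le_mul_left _ (Nat.sub_le _ _)
  -- `2Δ²p^α < 1/2`
  have hp1 : p ≤ 1 := (hpp₀.le).trans hp₀le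
  have hpα : p ^ α < p₀ ^ α := Real.rpow_lt_rpow hp0 hpp₀ hα
  set ρ : ℝ := 2 * (Δ : ℝ) ^ 2 * p ^ α with hρdef
  have hΔ2pos : (0 : ℝ) < 2 * (Δ : ℝ) ^ 2 := by linarith
  have hρ0 : 0 ≤ ρ := by rw [hρdef]; exact mul_nonneg hΔ2pos.le (Real.rpow_nonneg hp0 α)
  have hρhalf : ρ < 1 / 2 := by
    have h : ρ < 2 * (Δ : ℝ) ^ 2 * p₀ ^ α := by
      rw [hρdef]; exact mul_lt_mul_of_pos_left hpα hΔ2pos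
    rw [hp₀α] at h
    have hΔne : (Δ : ℝ) ^ 2 ≠ 0 := by positivity
    have h' : 2 * (Δ : ℝ) ^ 2 * (4 * (Δ : ℝ) ^ 2)⁻¹ = 1 / 2 := by
      field_simp; ring
    linarith [h'.le, h'.ge]
  have hρ1 : ρ < 1 := by linarith
  -- `ρ = (p/p₀)^α / 2 ≤ (p/p₀)^α`
  set x : ℝ := p / p₀ with hxdef
  have hx0 : 0 ≤ x := div_nonneg hp0 hp₀pos.le
  have hx1 : x ≤ 1 := (div_le_one hp₀pos).2 hpp₀.le
  have hxα : x ^ α = 4 * (Δ : ℝ) ^ 2 * p ^ α := by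
    rw [hxdef, Real.div_rpow hp0 hp₀pos.le, hp₀α, div_inv_eq_mul, mul_comm]
  have hρx : ρ ≤ x ^ α := by
    have h := hρ0
    rw [hρdef] at h
    rw [hxα, hρdef]
    linarith
  -- the generic bound
  have hgen := SmallSetFlip.sum_not_corrects_le_geometric (G := G) hGX hGZ hκ hdM'.le hw ht₀ hcorr hD hdeg hΔ1
    hμ hp0 hp1 (by rw [← hαdef, ← hρdef]; exact hρ1)
  rw [← hαdef, ← hρdef, hV] at hgen
  -- simplify the geometric bound: `≤ 2 n ρ^t`
  set t : ℕ := ⌊t₀⌋₊ + 1 with htdef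
  have hn0 : 0 ≤ nA ^ 2 + nB ^ 2 := by positivity
  have hstep1 : (nA ^ 2 + nB ^ 2) * ρ ^ t / ((Δ : ℝ) ^ 2 * (1 - ρ)) ≤ 2 * (nA ^ 2 + nB ^ 2) * ρ ^ t := by
    have hden : (1 : ℝ) / 2 ≤ (Δ : ℝ) ^ 2 * (1 - ρ) := by
      calc (1 : ℝ) / 2 = 1 * (1 / 2) := by norm_num
        _ ≤ (Δ : ℝ) ^ 2 * (1 - ρ) := mul_le_mul hΔsq (by linarith) (by norm_num) (by positivity)
    calc (nA ^ 2 + nB ^ 2) * ρ ^ t / ((Δ : ℝ) ^ 2 * (1 - ρ))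
        ≤ (nA ^ 2 + nB ^ 2) * ρ ^ t / (1 / 2) :=
          div_le_div_of_nonneg_left (mul_nonneg hn0 (pow_nonneg hρ0 t)) (by norm_num) hden
      _ = 2 * (nA ^ 2 + nB ^ 2) * ρ ^ t := by ring
  -- `ρ^t ≤ x^{αt} ≤ x^{C'√n}`
  have hstep2 : ρ ^ t ≤ x ^ (α * t) := by
    calc ρ ^ t ≤ (x ^ α) ^ t := pow_le_pow_left₀ hρ0 hρx t
      _ = x ^ (α * t) := by rw [Real.rpow_mul hx0, Real.rpow_natCast]
  have hexpo : C' * Real.sqrt (nA ^ 2 + nB ^ 2) ≤ α * t := by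
    have hs : Real.sqrt (nA ^ 2 + nB ^ 2) ≤ 2 * max nA nB := sqrt_sq_add_sq_le_two_max hnA hnB
    have hmin : m * max nA nB ≤ min (γA * nA) (γB * nB) := by
      have h := min_mul_max_le_min hnA hnB hdA' hdB' hγA.le hγB.le hAB
      rw [← Nat.cast_min, ← Nat.cast_max] at h
      rw [hmdef, hdmdef, hdMdef]
      exact h
    have htt : t₀ < (t : ℝ) := by
      rw [htdef]; push_cast; exact Nat.lt_floor_add_one t₀
    calc C' * Real.sqrt (nA ^ 2 + nB ^ 2) ≤ C' * (2 * max nA nB) := mul_le_mul_of_nonneg_left hs hC'.le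
      _ = α * (c₀ * (m * max nA nB)) := by rw [hC'def]; ring
      _ ≤ α * (c₀ * min (γA * nA) (γB * nB)) :=
          mul_le_mul_of_nonneg_left (mul_le_mul_of_nonneg_left hmin hc₀.le) hα.le
      _ = α * t₀ := by rw [ht₀def]
      _ ≤ α * t := mul_le_mul_of_nonneg_left htt.le hα.le
  have hstep3 : x ^ (α * t) ≤ x ^ (C' * Real.sqrt (nA ^ 2 + nB ^ 2)) := by
    rcases hx0.eq_or_lt with hx00 | hxpos
    · -- `p = 0`: the left-hand side vanishes
      have htpos : (0 : ℝ) < t := by rw [htdef]; positivity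
      rw [← hx00, Real.zero_rpow (mul_pos hα htpos).ne']
      exact Real.rpow_nonneg le_rfl _
    · exact Real.rpow_le_rpow_of_exponent_ge hxpos hx1 hexpo
  -- assemble
  calc _ ≤ (nA ^ 2 + nB ^ 2) * ρ ^ t / ((Δ : ℝ) ^ 2 * (1 - ρ)) := hgen
    _ ≤ 2 * (nA ^ 2 + nB ^ 2) * ρ ^ t := hstep1
    _ ≤ 2 * (nA ^ 2 + nB ^ 2) * x ^ (C' * Real.sqrt (nA ^ 2 + nB ^ 2)) :=
        mul_le_mul_of_nonneg_left (hstep2.trans hstep3) (by positivity)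

/-- **Fawzi–Grospellier–Leverrier 2018, Theorem 1, PROVED as FIRST typed — discharges the named fact
`FGL18_theorem1`** (Algorithm 1 / `κ = 0`, local stochastic noise, `X`-sector, NO order assumed between `Δ_A` and
`Δ_B`): "Consider a quantum expander code with sufficient expansion and the small-set-flip decoding algorithm
(Algorithm 1). Then there exists a probability `p₀ > 0` and constants `C, C'` such that if the noise parameter
satisfies `p < p₀`, the small-set-flip decoding algorithm corrects a random error with probability at least
`1 - Cn(p/p₀)^{C'√n}`." The typed fact omits the source's convention `Δ_A ≤ Δ_B` and was recorded as "stronger than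
printed, no witness known"; it is TRUE: the convention only shapes the constants of Prop 11, and Theorem 1 asks for
SOME `p₀, C, C'` (`fgl18_theorem1_minmax` with `κ = 0`).
[cite: FawziGrospellierLeverrier2018, Thm 1 (§1, arXiv v2 p0004) and its proof (§4, p0014 L7; Remark 9, p0011 L1-2)] -/
theorem FGL18_theorem1_holds : FGL18_theorem1 := by
  intro dA dB γA δA γB δB hdA hdB hγA hδA hγB hδB hβ
  obtain ⟨p₀, C, C', hp₀, hC', hmain⟩ :=
    fgl18_theorem1_minmax dA dB γA δA γB δB hdA hdB hγA hδA hγB hδB hβ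
  refine ⟨p₀, C, C', hp₀, hC', ?_⟩
  intro A B _ _ _ _ H hreg hexp D hD p μ hp0 hpp₀ hμ
  have hβ' : 0 < betaZero (min dA dB) (max dA dB) δA δB := (betaZero_minmax_pos_iff hdA hdB δA δB).2 hβ
  have hκ : (0 : ℝ) ≤ betaZero (min dA dB) (max dA dB) δA δB * ((max dA dB : ℕ) : ℝ) :=
    mul_nonneg hβ'.le (Nat.cast_nonneg _)
  exact hmain A B H hreg hexp 0 hκ D hD p μ hp0 hpp₀ hμ

/-- `FGL18_theorem1` holds — alias of `QuantumExpander.FGL18_theorem1_holds` above under the fact's own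
namespace `Literature.InformationTheory.QuantumCodes` (appended 2026-08-28, D-0026 bookkeeping: the proof
term is the existing theorem of this file; no statement, definition or attribute is edited; no new named
fact; the ledger listed the fact unproved because the discharge lived one namespace down).
[cite: FawziGrospellierLeverrier2018, Thm 1 (§1, arXiv v2 p0004) and its proof (§4, p0014 L7; Remark 9, p0011 L1-2)] -/
theorem _root_.Literature.InformationTheory.QuantumCodes.FGL18_theorem1_holds : FGL18_theorem1 :=
  QuantumExpander.FGL18_theorem1_holds

end Threshold

/-! ### The `Z`-sector: the reversed graph `Hᵀ` -/

section ZSector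

/-- `β₀` is symmetric in the expansion defects `δ_A, δ_B` (only `δ_A + δ_B` and `(δ_B − δ_A)²` enter).
[cite: FawziGrospellierLeverrier2018, Def 10 (§3.2, arXiv v2 p0011)] -/
theorem betaZero_symm_delta (dA dB : ℕ) (δA δB : ℝ) : betaZero dA dB δB δA = betaZero dA dB δA δB := by
  unfold betaZero; ring

/-- **FGL18 Proposition 11, `Z`-sector** (the reversed graph `Hᵀ`, degrees `(Δ_B, Δ_A)`), for EVERY biregular
expander and every parameter `κ ≤ β̃·max(Δ_A,Δ_B)`: every small-set-flip decoder of `Q_{Hᵀ}` corrects every error of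
weight `≤ (r̃β̃/(1+β̃))·min(γ_A n_A, γ_B n_B)` — `fgl18_proposition11_minmax_of_le` at `Hᵀ` (the constants are symmetric
under `A ↔ B`). [cite: FawziGrospellierLeverrier2018, Prop 11 (§3.2, arXiv v2 p0011); §2.3 (X- and Z-type errors decoded independently)] -/
theorem fgl18_proposition11_transpose {A B : Type*} [Fintype A] [Fintype B] [DecidableEq A] [DecidableEq B]
    (H : Matrix B A (ZMod 2)) {dA dB : ℕ} {γA δA γB δB : ℝ}
    (hreg : IsBiregular H dA dB) (hexp : IsLeftRightExpanding H dA dB γA δA γB δB)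
    (hdA : 0 < dA) (hdB : 0 < dB) (hδA : 0 < δA) (hδB : 0 < δB)
    (hβ : 0 < betaZero (min dA dB) (max dA dB) δA δB)
    {κ : ℝ} (hκ : κ ≤ betaZero (min dA dB) (max dA dB) δA δB * ((max dA dB : ℕ) : ℝ))
    {D : Decoder (B × A → ZMod 2) ((B × B) ⊕ (A × A) → ZMod 2)}
    (hD : IsSSFDecoder κ (expanderHX Hᵀ) (expanderHZ Hᵀ) D)
    {e : (B × B) ⊕ (A × A) → ZMod 2}
    (he : (hammingNorm e : ℝ) ≤
      ((min dA dB : ℕ) : ℝ) / ((max dA dB : ℕ) : ℝ) * betaZero (min dA dB) (max dA dB) δA δB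
        / (1 + betaZero (min dA dB) (max dA dB) δA δB) * min (γA * Fintype.card A) (γB * Fintype.card B)) :
    D.Corrects (fun x => expanderHX Hᵀ *ᵥ x)
      (rowSpace (expanderHZ Hᵀ) : Set ((B × B) ⊕ (A × A) → ZMod 2)) e := by
  have hregT : IsBiregular Hᵀ dB dA := isBiregular_transpose H hreg
  have hexpT : IsLeftRightExpanding Hᵀ dB dA γB δB γA δA := by
    refine ⟨(isLeftExpanding_transpose_iff H dB γB δB).2 hexp.2, ?_⟩
    have h : IsLeftExpanding Hᵀᵀ dA γA δA := by rw [Matrix.transpose_transpose]; exact hexp.1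
    exact (isLeftExpanding_transpose_iff Hᵀ dA γA δA).1 h
  have hsymm : betaZero (min dB dA) (max dB dA) δB δA = betaZero (min dA dB) (max dA dB) δA δB := by
    rw [min_comm, max_comm, betaZero_symm_delta]
  refine fgl18_proposition11_minmax_of_le Hᵀ hregT hexpT hdB hdA hδB hδA (by rw [hsymm]; exact hβ)
    (by rw [hsymm, max_comm dB dA]; exact hκ) hD ?_
  rw [hsymm, min_comm dB dA, max_comm dB dA, min_comm (γB * _)]
  exact he

open Classical in
/-- **FGL18 Theorem 1, `Z`-sector** ("the other case being symmetric"): for EVERY `(Δ_A, Δ_B)`-biregular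
`(γ_A, δ_A, γ_B, δ_B)`-expanding `G` with `β₀ > 0` — no order between the degrees — the small-set-flip decoders of
the REVERSED graph `Hᵀ` (degrees `(Δ_B, Δ_A)`, parameters `(γ_B, δ_B, γ_A, δ_A)`; syndrome `H_X(Hᵀ)`, corrections
modulo `rowsp H_Z(Hᵀ)` — the `Z`-sector of `Q_G` in the tree's one-sector typing), of every parameter
`κ ≤ β̃·max(Δ_A,Δ_B)` (Algorithm 1 included), obey the same local-stochastic failure bound
`≤ C (n_A² + n_B²) (p/p₀)^{C'√(n_A² + n_B²)}`. Immediate from `fgl18_theorem1_minmax` at `Hᵀ`, available because that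
theorem needs no convention (the reversed graph has `Δ_A(Hᵀ) = Δ_B`).
[cite: FawziGrospellierLeverrier2018, Thm 1 (§1, arXiv v2 p0004); §2.3 (X- and Z-type errors decoded independently)] [cite: LeverrierTillichZemor2015, §3 ("the other case being symmetric"; arXiv v1 p0007 L40-44)] -/
theorem fgl18_theorem1_transpose :
    ∀ (dA dB : ℕ) (γA δA γB δB : ℝ), 0 < dA → 0 < dB → 0 < γA → 0 < δA → 0 < γB → 0 < δB →
      0 < betaZero dA dB δA δB →
      ∃ (p₀ C C' : ℝ), 0 < p₀ ∧ 0 < C' ∧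
        ∀ (A B : Type) [Fintype A] [Fintype B] [DecidableEq A] [DecidableEq B]
          (H : Matrix B A (ZMod 2)),
          IsBiregular H dA dB → IsLeftRightExpanding H dA dB γA δA γB δB →
          ∀ κ : ℝ, κ ≤ betaZero (min dA dB) (max dA dB) δA δB * ((max dA dB : ℕ) : ℝ) →
          ∀ D : Decoder (B × A → ZMod 2) ((B × B) ⊕ (A × A) → ZMod 2),
            IsSSFDecoder κ (expanderHX Hᵀ) (expanderHZ Hᵀ) D →
            ∀ (p : ℝ) (μ : Finset ((B × B) ⊕ (A × A)) → ℝ), 0 ≤ p → p < p₀ →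
              IsLocallyStochastic μ p →
              (∑ E ∈ univ.filter (fun E : Finset ((B × B) ⊕ (A × A)) =>
                  ¬ D.Corrects (fun x => expanderHX Hᵀ *ᵥ x) (rowSpace (expanderHZ Hᵀ) : Set _)
                    (flipVec E)), μ E) ≤
                C * ((Fintype.card A : ℝ) ^ 2 + (Fintype.card B : ℝ) ^ 2) *
                  (p / p₀) ^ (C' * Real.sqrt ((Fintype.card A : ℝ) ^ 2 + (Fintype.card B : ℝ) ^ 2)) := by
  intro dA dB γA δA γB δB hdA hdB hγA hδA hγB hδB hβ
  have hβT : 0 < betaZero dB dA δB δA := by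
    rw [betaZero_symm_delta, betaZero_pos_iff hdB hdA]
    exact (betaZero_pos_iff hdA hdB δA δB).1 hβ
  obtain ⟨p₀, C, C', hp₀, hC', hmain⟩ :=
    fgl18_theorem1_minmax dB dA γB δB γA δA hdB hdA hγB hδB hγA hδA hβT
  refine ⟨p₀, C, C', hp₀, hC', ?_⟩
  intro A B _ _ _ _ H hreg hexp κ hκ D hD p μ hp0 hpp₀ hμ
  have hregT : IsBiregular Hᵀ dB dA := isBiregular_transpose H hreg
  have hexpT : IsLeftRightExpanding Hᵀ dB dA γB δB γA δA := by
    refine ⟨(isLeftExpanding_transpose_iff H dB γB δB).2 hexp.2, ?_⟩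
    have h : IsLeftExpanding Hᵀᵀ dA γA δA := by rw [Matrix.transpose_transpose]; exact hexp.1
    exact (isLeftExpanding_transpose_iff Hᵀ dA γA δA).1 h
  have hκ' : κ ≤ betaZero (min dB dA) (max dB dA) δB δA * ((max dB dA : ℕ) : ℝ) := by
    rw [min_comm, max_comm, betaZero_symm_delta]; exact hκ
  have h := hmain B A Hᵀ hregT hexpT κ hκ' D hD p μ hp0 hpp₀ hμ
  rw [add_comm ((Fintype.card B : ℝ) ^ 2)] at h
  exact h

end ZSector

end QuantumExpander

end Literature.InformationTheory.QuantumCodes
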